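import Summits.BirchSwinnertonDyer.BirchSwinnertonDyer.Theorems.EdixhovenFibreFiveSevenTwistDegreeStepFiveSevenCellFiveII
import HarnessLib

/-!
# Crux TDS57 `TwistDegreeStepFiveSeven` (stmt-BirchSwinnertonDyer-22227) BY NAME, GRANTED {P1-bar, [REC-tower] (or hT₂)} and KP57

Cell `pub/bsd-wall`, seat `bsd-line-edix-p1` g18 (LEAD of line `kato_lever`; `--supports` 22227 as a helper). TOOL theorems only; nothing
is closed; BSD is not proved by any of this.

WHAT. The tree's by-name closer `TwistDegreeStepFiveSeven.twistDegreeStepFiveSeven_of_kato_of_kpResidue : F″ → KP57 → TDS57` read F″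
(`kato_neron_isIntegral_twistedSymbolSum_of_additive_five_le`, a COMPOSITE cite whose value law inherits the `χ̄`-erratum DD-UE-1) off the
Kosters–Pannekoek sub-residue. With `TwistDegreeStepFiveSevenCellFiveII.twistDegreeStep57_of_sl2NeronValuesBar_of_noTorsion` (this seat:
the de Rham input DISCHARGED on every cell of TDS57's locus) the same assembly runs from the print-faithful P1-bar and hT₂ — or Kato's
explicit reciprocity law [REC-tower] (p700964) — instead of F″:

* ★★ `twistDegreeStepFiveSeven_of_expStarTower_of_sl2NeronValuesBar_of_kpResidue : hT₂ → P1-bar → KP57 → TDS57`;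
* ★★ `twistDegreeStepFiveSeven_of_reciprocityLaw_of_sl2NeronValuesBar_of_kpResidue : [REC-tower] → P1-bar → KP57 → TDS57`.

KP57 (hypothesis `hKP`, verbatim as in `…_of_kato_of_kpResidue`; the item `KPResidueManinUnitFiveSeven`, stmt-BirchSwinnertonDyer-23810, OPEN)
= Manin's `p`-part, SOME conductor-level datum, on the classes with a `ℚ_p`-rational point of order `p` (Kodaira II/III at `5`, II at `7`
only, `kp_types_of_torsion_witness`). So TDS57 ⟸ {P1-bar, [REC-tower], KP57}: the same two printed inputs as K★ (22226) plus the KP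
sub-residue. CONDITIONAL; the item stays OPEN.

References: [Kato2004Asterisque] Thm. 6.6 (1), (8.1.3), Thm. 9.7; [Kato1993LNM1553] Ch. II Thm. 1.4.1 (4); [KostersPannekoek2017] Thm. 1,
Cor. 2; [EdixhovenManin1991] §4.
-/

set_option autoImplicit false
-- the Theorems namespace of a single-conjunct summit repeats the summit name by design (D-0017)
set_option linter.dupNamespace false

noncomputable section

open scoped Classical MatrixGroups NumberField

open WeierstrassCurve NumberField IsDedekindDomain Field ValuativeRel
  Literature.NumberTheory.EllipticCurves Literature.NumberTheory.EllipticCurves.ModularForms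
  Literature.NumberTheory.EllipticCurves.Rank1Residual Literature.NumberTheory.EllipticCurves.Kato2004
  Literature.NumberTheory.DiophantineGeometry Rat.HeightOneSpectrum
  Literature.NumberTheory.PAdicHodge Literature.NumberTheory.GaloisRepresentations
  Summit.BirchSwinnertonDyer.Rank1Residual Summit.BirchSwinnertonDyer.Rank1Residual.Additive
  Summit.BirchSwinnertonDyer.BirchSwinnertonDyer.Theorems
  Summit.BirchSwinnertonDyer.BirchSwinnertonDyer.Theorems.TwistDegreeStepFiveSeven
  Summit.BirchSwinnertonDyer.BirchSwinnertonDyer.Theorems.TwistDegreeStepFiveSevenCellFiveII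
  Summit.BirchSwinnertonDyer.BirchSwinnertonDyer.Theses.EdixhovenFibreFiveSeven

namespace Summit.BirchSwinnertonDyer.BirchSwinnertonDyer.Theorems.TwistDegreeStepFiveSevenOfReciprocityLawOfKP

/-- ★★ **TDS57 `TwistDegreeStepFiveSeven` GRANTED hT₂, P1-bar and KP57** — `twistDegreeStepFiveSeven_of_kato_of_kpResidue` with the off-KP
lever read from {hT₂, P1-bar, modularity} and the de Rham input discharged on every cell (`twistDegreeStep57_of_sl2NeronValuesBar_of_noTorsion`).
CONDITIONAL; the item is not closed. [cite: Kato2004Asterisque, Thm. 6.6 (1) (p. 163), (8.1.3) (p. 180), Thm. 9.7 (p. 189)]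
[cite: Kato1993LNM1553, Ch. II Thm. 1.4.1 (3)–(4)] [cite: KostersPannekoek2017, Thm. 1 and Cor. 2] [cite: EdixhovenManin1991, §4 (cases 1/2)] -/
theorem twistDegreeStepFiveSeven_of_expStarTower_of_sl2NeronValuesBar_of_kpResidue
    (hT₂ : exists_smul_range_expStarCoord_tower_iff_trace_log) (hP1 : exists_member_sl2ZetaElement_neron_values_bar)
    (hKP : ∀ (p : ℕ) [Fact p.Prime] (V : WeierstrassCurve ℚ) [V.IsElliptic] [V.IsGloballyMinimal]
      [NeZero (V.conductorNorm ℤ)], (p = 5 ∨ p = 7) → Addv V p → Irr V p →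
      (∀ (v : HeightOneSpectrum ℤ) (n : ℕ), natGenerator v = p →
        V.kodairaSymbolAt v ≠ KodairaSymbol.Istar n) →
      padicValInt p V.minimalDiscriminantInt ≤ 4 →
      (∃ (W' : WeierstrassCurve ℚ) (_ : W'.IsElliptic) (_ : W'.IsGloballyMinimal)
        (P : (W'.baseChange ℚ_[p]).toAffine.Point), IsIsogenous V W' ∧ P ≠ 0 ∧ p • P = 0) →
      ∃ D : ModularParametrizationData V (V.conductorNorm ℤ), ¬ (p : ℤ) ∣ D.c) :
    TwistDegreeStepFiveSeven := by
  intro hnf p _ V _ _ _ Wf _ _ _ C hp57 hadd hirr hK hV4 hC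
  by_cases hPT : ∀ (W' : WeierstrassCurve ℚ) [W'.IsElliptic] [W'.IsGloballyMinimal], IsIsogenous V W' →
      ∀ P : (W'.baseChange ℚ_[p]).toAffine.Point, p • P = 0 → P = 0
  · exact twistDegreeStep57_of_sl2NeronValuesBar_of_noTorsion hT₂ hP1 hnf V Wf C hp57 hadd hirr hK hV4 hC hPT
  · push Not at hPT
    obtain ⟨W', hE', hM', hiso, P, hP, hP0⟩ := hPT
    obtain ⟨D, hc⟩ := hKP p V hp57 hadd hirr hK hV4 ⟨W', hE', hM', P, hiso, hP0, hP⟩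
    exact ⟨D, twistDegreeStep57_of_not_dvd_c (by omega) V Wf hadd hK hV4 C hC D hc⟩

/-- ★★ **TDS57 `TwistDegreeStepFiveSeven` GRANTED Kato's explicit reciprocity law [REC-tower], P1-bar and KP57** (hT₂ :=
`exists_smul_range_expStarCoord_tower_iff_trace_log_of_reciprocityLaw hrec`, p700964). CONDITIONAL; the item is not closed.
[cite: Kato1993LNM1553, Ch. II Thm. 1.4.1 (4), Lemma 1.4.3–1.4.5] [cite: Kato2004Asterisque, (8.1.3) (p. 180), Thm. 9.7 (p. 189)]
[cite: KostersPannekoek2017, Thm. 1 and Cor. 2] -/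
theorem twistDegreeStepFiveSeven_of_reciprocityLaw_of_sl2NeronValuesBar_of_kpResidue
    (hrec : tatePairingPoint_eq_trace_expStar_log_tower) (hP1 : exists_member_sl2ZetaElement_neron_values_bar)
    (hKP : ∀ (p : ℕ) [Fact p.Prime] (V : WeierstrassCurve ℚ) [V.IsElliptic] [V.IsGloballyMinimal]
      [NeZero (V.conductorNorm ℤ)], (p = 5 ∨ p = 7) → Addv V p → Irr V p →
      (∀ (v : HeightOneSpectrum ℤ) (n : ℕ), natGenerator v = p →
        V.kodairaSymbolAt v ≠ KodairaSymbol.Istar n) →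
      padicValInt p V.minimalDiscriminantInt ≤ 4 →
      (∃ (W' : WeierstrassCurve ℚ) (_ : W'.IsElliptic) (_ : W'.IsGloballyMinimal)
        (P : (W'.baseChange ℚ_[p]).toAffine.Point), IsIsogenous V W' ∧ P ≠ 0 ∧ p • P = 0) →
      ∃ D : ModularParametrizationData V (V.conductorNorm ℤ), ¬ (p : ℤ) ∣ D.c) :
    TwistDegreeStepFiveSeven :=
  twistDegreeStepFiveSeven_of_expStarTower_of_sl2NeronValuesBar_of_kpResidue
    (exists_smul_range_expStarCoord_tower_iff_trace_log_of_reciprocityLaw hrec) hP1 hKP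

end Summit.BirchSwinnertonDyer.BirchSwinnertonDyer.Theorems.TwistDegreeStepFiveSevenOfReciprocityLawOfKP

end
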